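import Literature.MathematicalPhysics.QuantumFieldTheory.Balaban1983to89.B16Ineq175Tilted

/-!
# `Balaban1983to89.B16DressedActionTerm` — [Balaban1989LargeFieldII] (1.73)–(1.75) p. 380 with a source-tilted observable
# attached, EXPONENTIATED: the born dressed action term `D_t = Log 𝐓′ₜ(X)1 − Log 𝐓′₀(X)1` of one complex-weight step, its
# holomorphy in the source, its first-order (birth) size, its (1.73)∕(1.74) real-part sandwich, its second-order remainder past
# the linear part `t·⟨W⟩`, its OSCILLATION form (only the fibre-oscillation of the observable is born) and the factorisation
# «dressed un-normalised term = undressed normalisation × e^{D_t} × tilted expectation»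

CITATION HEADER (lean-in-tree rule 2026-08-18).  Source: T. Bałaban, *Large field renormalization. II. Localization,
exponentiation, and bounds for the 𝐑 operation*, Commun. Math. Phys. **122**, 355–392 (1989), doi:10.1007/bf01238433
[Balaban1989LargeFieldII] (cell paper B16; held: `paper:balaban1989-cmp122-large-field-ii`; journal page = PDF page + 354).
WHAT IS PRINTED (pp. 379–380 [25–26]): the representation of the operation 𝐓′_k(X) for a regular real configuration with
*"the additional small, and possible complex valued, term in the exponential"* σ and the three inequalities
*"|𝐓′_k(X,(𝐔,𝐉))F| … ≤ (𝐓′_k(X,(U,0))1) sup e^{|σ|}|F| (1.73)"*, *"|𝐓′_k(X,(𝐔,𝐉))1| … ≥ (𝐓′_k(X,(U,0))1)e^{−2sup|σ|} (1.74)"*,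
*"|(𝐓′_k(X,(𝐔,𝐉))1)⁻¹𝐓′_k(X,(𝐔,𝐉))F| ≤ e^{3sup|σ|}sup|F| (1.75)"*, used in (1.72)'s EXPONENTIATED representation of the
𝐑-operation (the paper's title: «Localization, exponentiation, …»; the terms 𝐑′(X) are logarithms of normalised operations);
p. 356 [2] ll. 1–6 defers *"expectation values of physical observables, like loop variables"* to a further publication
(T. Bałaban, M. O'Carroll, CMP **199** (1999) 493 — NOT HELD, acq-04013, cite-only).

WHY THIS FILE (HUMAN RULING D-0062, Track A; DAG node N14 = NE1′ «dressed stability, observable-attached, μ-uniform — NOT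
PRINTED»; seat dag-n14-c, strategy s1 «direct first-missing estimate», `--supports` K3).  The sibling `B16Ineq175Tilted`
(dag-n14-b, p409237∕p410590) typed the observable-attached (1.73)ₜ–(1.75)ₜ for the normalised EXPECTATION `h ↦ E_t h` and its
source derivative (the covariance).  What a dressed 𝐑-step BOOKS, however, is the born term IN THE EXPONENTIAL: with the
observable `W` (‖W‖ ≤ B) attached through the source `t`, the normalisation `𝐓′ₜ(X)1 = ∫ρ₀e^{σ+tW}dμ` factors as
`𝐓′₀(X)1 · e^{D_t}`, and `D_t` — the DRESSED ACTION TERM born at the step — is the additional complex term the NEXT step sees in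
its exponential.  No tree file takes the logarithm of the complex tilted normalisation (`T4DressingDefect.dTerm` is the
REAL-density twin: the cumulant generating function of a probability law, [Balaban1989LargeFieldI] (0.3) in convention (α);
for [B16]'s complex σ Mathlib's `cgf` ∕ `Measure.tilted` do not apply).  This module supplies, in [B16]'s own currency:
* §1 `tiltNorm` (= 𝐓′ₜ(X)1 = ∫ρ₀e^{σ+tW}dμ), its positive real part on the tilt disc `s + |t|B ≤ 1` ((1.74)ₜ) hence membership in
  the slit plane, the two-sided modulus sandwich `(∫ρ₀)e^{−2(s+|t|B)} ≤ ‖𝐓′ₜ1‖ ≤ (∫ρ₀)e^{s+|t|B}` ((1.73)ₜ∕(1.74)ₜ), its source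
  derivative `∫ρ₀e^{σ+tW}W`; `dressLog μ ρ₀ σ W t := Log 𝐓′ₜ1 − Log 𝐓′₀1` (principal logarithms, legitimate on the disc);
  `dressLog_zero`; `exp_dressLog_mul` (𝐓′ₜ1 = e^{D_t}·𝐓′₀1); `integral_tiltWeight_smul_eq` (the factorisation of the dressed
  un-normalised term: `∫ρ₀e^{σ+tW}•h = (e^{D_t}·𝐓′₀1) • E_t h`).
* §2 holomorphy: `hasDerivAt_dressLog` — on the closed tilt disc `d∕dt D_t = E_t W`, the tilted mean of the observable itself
  (the scalar instance of the sibling's `tiltedMean`); `differentiableOn_dressLog`, `analyticOnNhd_dressLog` on the open disc.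
* §3 sizes: `norm_dressLog_le` — THE BIRTH SIZE `‖D_t‖ ≤ B·e^{3(s+|t|B)}·|t|`, FIRST ORDER in the source radius and in the
  observable's bound (mean value inequality with (1.75)ₜ on the derivative); `re_dressLog_le` ∕ `neg_le_re_dressLog` — the
  derivative-free real-part sandwich `−(3s + 2|t|B) ≤ Re D_t ≤ 3s + |t|B` read off (1.73)ₜ∕(1.74)ₜ (`Complex.log_re`).
* §4 the oscillation form and the second order: `tiltedMean_add_const` (the normalised expectation is blind to a constant shift
  of the observable: `e^{tc}` cancels), `tiltedMean_sub_const` (linearity in the integrand), `norm_dressLog_sub_mul_le` —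
  `‖D_t − t·c‖ ≤ B₀·e^{3(s+|t|B₀)}·|t|` whenever `‖W − c‖ ≤ B₀`: only the OSCILLATION of the observable over the integrated
  fibre is born beyond the field-independent constant `t·c` (this is where the geometric rate `θ^{K−k}` of the cell's
  `T4AvgSensitivity.LoopOscBound` ∕ `T4AvgDerivBound.LoopDerivBound` is consumed by the dressed bookkeeping: a unit-scale loop
  pulled back through `K − k` averagings oscillates by `C_W|Λ|θ^{K−k}` over a scale-`k` fibre); `norm_dressLog_sub_linear_le` —
  `‖D_t − t·E₀W‖ ≤ 2B²·e^{6(s+|t|B)}·|t|²`: past its LINEAR part `t·⟨W⟩₀` (the part `T4FirstOrderSize` charges to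
  [Balaban1988RG2Cluster] (2.20)'s quadratic currency) the born term is SECOND order in the amplitude.
* §5 `norm_iteratedDeriv_dressLog_succ_le` — Cauchy bounds on all higher source derivatives of `D` (from the sibling's v1.1
  Cauchy bounds on `E_t W`).

HONEST FRAMING.  (1.73)–(1.75) are printed for the ACTION's representation only; the tilted∕dressed objects are NOT PRINTED in
[B16]; every declaration below is a definition, a substitution instance of a tree theorem (cited to the display it instantiates)
or folklore complex calculus (logarithmic derivative, mean value inequality, Cauchy estimate) about the integrals of the cited
displays, whose locator is the tag.  Nothing is asserted about Bałaban's densities: `μ`, `ρ₀`, `σ`, `W`, `h`, `c` are arbitrary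
data under the displayed hypotheses; whether the genuine 𝐓′_k(X,(𝐔,𝐉)) with the loop observable attached meets them, and the
multi-scale booking of the born terms, is the node's OBJECT-level content (NODE O; `pub-balaban-gaps` row NE1′: WORK-bound as
mathematics, OBJECT-bound in Lean).  Not a discharge of N14; count-neutral; nothing continuum ∕ ℝ⁴ ∕ OS ∕ mass-gap ∕ Clay.
0 sorry, axioms standard; no existing module is modified; imports the sibling `B16Ineq175Tilted` only.
-/

noncomputable section

namespace Literature.MathematicalPhysics.QuantumFieldTheory.Balaban1983to89.B16DressedActionTerm

open _root_.MeasureTheory _root_.Filter _root_.Metric _root_.Set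
open scoped _root_.Topology
open Literature.MathematicalPhysics.QuantumFieldTheory.Balaban1983to89.T4TrajectoryDensity
open Literature.MathematicalPhysics.QuantumFieldTheory.Balaban1983to89.B16Ineq175Tilted

variable {Z : Type*} {F : Type*} [NormedAddCommGroup F] [NormedSpace ℂ F]

/-! ## §1 The tilted normalisation, its logarithm, the factorisation -/

/-- **The tilted normalisation** `𝐓′ₜ(X)1 = ∫ρ₀e^{σ+tW}dμ` — print's 𝐓′_k(X,(𝐔,𝐉))1 of (1.74) with the observable `e^{tW}`
inside (the denominator of the sibling's `tiltedMean`). [cite: Balaban1989LargeFieldII, (1.74) p.380] -/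
def tiltNorm [MeasurableSpace Z] (μ : Measure Z) (ρ₀ : Z → ℝ) (σ W : Z → ℂ) (t : ℂ) : ℂ :=
  ∫ z, tiltWeight ρ₀ σ W t z ∂μ

/-- **THE BORN DRESSED ACTION TERM** `D_t := Log 𝐓′ₜ(X)1 − Log 𝐓′₀(X)1` (principal logarithms; on the tilt disc both
normalisations have positive real part, (1.74)ₜ, so the principal branch is the holomorphic one and `e^{D_t} = 𝐓′ₜ1 ∕ 𝐓′₀1`).
In (1.72)'s exponentiated representation this is the additional complex term in the exponential that the observable's source
generates at the step (the dressed analogue of 𝐑′(X); NOT PRINTED — p. 356 defers observables). [folklore] -/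
def dressLog [MeasurableSpace Z] (μ : Measure Z) (ρ₀ : Z → ℝ) (σ W : Z → ℂ) (t : ℂ) : ℂ :=
  Complex.log (tiltNorm μ ρ₀ σ W t) - Complex.log (tiltNorm μ ρ₀ σ W 0)

/-- Unfolding the tilted normalisation. [cite: Balaban1989LargeFieldII, (1.74) p.380] -/
theorem tiltNorm_def [MeasurableSpace Z] (μ : Measure Z) (ρ₀ : Z → ℝ) (σ W : Z → ℂ) (t : ℂ) :
    tiltNorm μ ρ₀ σ W t = ∫ z, tiltWeight ρ₀ σ W t z ∂μ := rfl

/-- No source, no dressed term: `D_0 = 0`. (NOT PRINTED as a display: bookkeeping on the normalisation of the cited (1.74),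
whose locator is the tag.) [cite: Balaban1989LargeFieldII, (1.74) p.380] -/
theorem dressLog_zero [MeasurableSpace Z] (μ : Measure Z) (ρ₀ : Z → ℝ) (σ W : Z → ℂ) : dressLog μ ρ₀ σ W 0 = 0 :=
  sub_self _

/-- A positive base mass forces `μ ≠ 0`, so an a.e. norm bound is witnessed somewhere: its constant is nonnegative (how `0 ≤ s`,
`0 ≤ B` follow from the displayed hypotheses; the sibling's private lemma, re-proved). [folklore] -/
private theorem nonneg_of_ae_norm_le' [MeasurableSpace Z] {μ : Measure Z} {ρ₀ : Z → ℝ} {g : Z → ℂ} {c : ℝ}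
    (hP : 0 < ∫ z, ρ₀ z ∂μ) (hg : ∀ᵐ z ∂μ, ‖g z‖ ≤ c) : 0 ≤ c := by
  have hμ : μ ≠ 0 := by
    intro h0; rw [h0, integral_zero_measure] at hP; exact lt_irrefl _ hP
  haveI : (ae μ).NeBot := ae_neBot.mpr hμ
  obtain ⟨z, hz⟩ := hg.exists
  exact (norm_nonneg _).trans hz

variable [MeasurableSpace Z] {μ : Measure Z} {ρ₀ : Z → ℝ} {σ W : Z → ℂ} {s B m : ℝ} {h : Z → F}

/-- **(1.74)ₜ for the normalisation**: on the tilt disc `s + |t|B ≤ 1` the tilted normalisation has real part at least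
`(∫ρ₀)·e^{−2(s+|t|B)} > 0`. [cite: Balaban1989LargeFieldII, (1.74) p.380] -/
theorem mul_exp_le_re_tiltNorm (hρ : Integrable ρ₀ μ) (hρ0 : 0 ≤ᵐ[μ] ρ₀) (hσm : AEStronglyMeasurable σ μ)
    (hWm : AEStronglyMeasurable W μ) (hσ : ∀ᵐ z ∂μ, ‖σ z‖ ≤ s) (hW : ∀ᵐ z ∂μ, ‖W z‖ ≤ B) {t : ℂ}
    (ht : s + ‖t‖ * B ≤ 1) :
    (∫ z, ρ₀ z ∂μ) * Real.exp (-(2 * (s + ‖t‖ * B))) ≤ (tiltNorm μ ρ₀ σ W t).re :=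
  mul_exp_le_re_integral_tiltWeight hρ hρ0 hσm hWm hσ hW ht

/-- On the tilt disc the tilted normalisation has POSITIVE REAL PART (given a positive base mass).
[cite: Balaban1989LargeFieldII, (1.74) p.380] -/
theorem re_tiltNorm_pos (hρ : Integrable ρ₀ μ) (hρ0 : 0 ≤ᵐ[μ] ρ₀) (hP : 0 < ∫ z, ρ₀ z ∂μ)
    (hσm : AEStronglyMeasurable σ μ) (hWm : AEStronglyMeasurable W μ) (hσ : ∀ᵐ z ∂μ, ‖σ z‖ ≤ s)
    (hW : ∀ᵐ z ∂μ, ‖W z‖ ≤ B) {t : ℂ} (ht : s + ‖t‖ * B ≤ 1) : 0 < (tiltNorm μ ρ₀ σ W t).re :=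
  lt_of_lt_of_le (mul_pos hP (Real.exp_pos _)) (mul_exp_le_re_tiltNorm hρ hρ0 hσm hWm hσ hW ht)

/-- Hence on the tilt disc the tilted normalisation lies in the slit plane, where the principal logarithm is holomorphic.
[cite: Balaban1989LargeFieldII, (1.74) p.380] -/
theorem tiltNorm_mem_slitPlane (hρ : Integrable ρ₀ μ) (hρ0 : 0 ≤ᵐ[μ] ρ₀) (hP : 0 < ∫ z, ρ₀ z ∂μ)
    (hσm : AEStronglyMeasurable σ μ) (hWm : AEStronglyMeasurable W μ) (hσ : ∀ᵐ z ∂μ, ‖σ z‖ ≤ s)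
    (hW : ∀ᵐ z ∂μ, ‖W z‖ ≤ B) {t : ℂ} (ht : s + ‖t‖ * B ≤ 1) : tiltNorm μ ρ₀ σ W t ∈ Complex.slitPlane :=
  Complex.mem_slitPlane_iff.mpr (Or.inl (re_tiltNorm_pos hρ hρ0 hP hσm hWm hσ hW ht))

/-- … and in particular does not vanish (print: *"hence 𝐓′_k(X,(𝐔,𝐉))1 ≠ 0"*). [cite: Balaban1989LargeFieldII, (1.74) p.380] -/
theorem tiltNorm_ne_zero (hρ : Integrable ρ₀ μ) (hρ0 : 0 ≤ᵐ[μ] ρ₀) (hP : 0 < ∫ z, ρ₀ z ∂μ)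
    (hσm : AEStronglyMeasurable σ μ) (hWm : AEStronglyMeasurable W μ) (hσ : ∀ᵐ z ∂μ, ‖σ z‖ ≤ s)
    (hW : ∀ᵐ z ∂μ, ‖W z‖ ≤ B) {t : ℂ} (ht : s + ‖t‖ * B ≤ 1) : tiltNorm μ ρ₀ σ W t ≠ 0 :=
  integral_tiltWeight_ne_zero hρ hρ0 hσm hWm hσ hW ht hP

/-- **(1.73)ₜ for the normalisation**: `‖𝐓′ₜ1‖ ≤ (∫ρ₀)·e^{s+|t|B}` (the scalar instance `h ≡ 1` of the sibling's (1.73)ₜ).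
[cite: Balaban1989LargeFieldII, (1.73) p.380] -/
theorem norm_tiltNorm_le (hρ : Integrable ρ₀ μ) (hρ0 : 0 ≤ᵐ[μ] ρ₀) (hσ : ∀ᵐ z ∂μ, ‖σ z‖ ≤ s)
    (hW : ∀ᵐ z ∂μ, ‖W z‖ ≤ B) (t : ℂ) : ‖tiltNorm μ ρ₀ σ W t‖ ≤ (∫ z, ρ₀ z ∂μ) * Real.exp (s + ‖t‖ * B) := by
  have h1 := norm_integral_tiltWeight_smul_le (F := ℂ) (h := fun _ => (1 : ℂ)) (m := 1) hρ hρ0 hσ hW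
    (Eventually.of_forall fun _ => by simp) t
  simpa only [tiltNorm, smul_eq_mul, mul_one] using h1

/-- **(1.74)ₜ for the modulus of the normalisation**: `(∫ρ₀)·e^{−2(s+|t|B)} ≤ ‖𝐓′ₜ1‖` on the tilt disc.
[cite: Balaban1989LargeFieldII, (1.74) p.380] -/
theorem mul_exp_le_norm_tiltNorm (hρ : Integrable ρ₀ μ) (hρ0 : 0 ≤ᵐ[μ] ρ₀) (hσm : AEStronglyMeasurable σ μ)
    (hWm : AEStronglyMeasurable W μ) (hσ : ∀ᵐ z ∂μ, ‖σ z‖ ≤ s) (hW : ∀ᵐ z ∂μ, ‖W z‖ ≤ B) {t : ℂ}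
    (ht : s + ‖t‖ * B ≤ 1) :
    (∫ z, ρ₀ z ∂μ) * Real.exp (-(2 * (s + ‖t‖ * B))) ≤ ‖tiltNorm μ ρ₀ σ W t‖ :=
  (mul_exp_le_re_tiltNorm hρ hρ0 hσm hWm hσ hW ht).trans (Complex.re_le_norm _)

/-- **EXPONENTIATION**: `e^{D_t} · 𝐓′₀1 = 𝐓′ₜ1` on the tilt disc — the dressed normalisation IS the undressed one times the
exponential of the born term. (NOT PRINTED as a display: folklore algebra of principal logarithms on the normalisations of the
cited (1.74), whose locator is the tag.) [cite: Balaban1989LargeFieldII, (1.74) p.380] -/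
theorem exp_dressLog_mul (hρ : Integrable ρ₀ μ) (hρ0 : 0 ≤ᵐ[μ] ρ₀) (hP : 0 < ∫ z, ρ₀ z ∂μ)
    (hσm : AEStronglyMeasurable σ μ) (hWm : AEStronglyMeasurable W μ) (hσ : ∀ᵐ z ∂μ, ‖σ z‖ ≤ s)
    (hW : ∀ᵐ z ∂μ, ‖W z‖ ≤ B) {t : ℂ} (ht : s + ‖t‖ * B ≤ 1) :
    Complex.exp (dressLog μ ρ₀ σ W t) * tiltNorm μ ρ₀ σ W 0 = tiltNorm μ ρ₀ σ W t := by
  have hB : 0 ≤ B := nonneg_of_ae_norm_le' hP hW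
  have h0 : s + ‖(0 : ℂ)‖ * B ≤ 1 := by
    rw [norm_zero, zero_mul, add_zero]; nlinarith [norm_nonneg t]
  have hne0 := tiltNorm_ne_zero hρ hρ0 hP hσm hWm hσ hW h0
  have hnet := tiltNorm_ne_zero hρ hρ0 hP hσm hWm hσ hW ht
  rw [dressLog, Complex.exp_sub, Complex.exp_log hnet, Complex.exp_log hne0, div_mul_cancel₀ _ hne0]

/-- **FACTORISATION OF THE DRESSED UN-NORMALISED TERM**: `∫ρ₀e^{σ+tW}•h dμ = (e^{D_t}·𝐓′₀1) • E_t h` on the tilt disc — the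
dressed term equals the undressed normalisation times `e^{D_t}` times the tilted normalised expectation (convention (α) read in
[B16]'s complex currency; the three factors are what the next step books: an old normalisation, a born exponential term, a carried
functional). (NOT PRINTED as a display: folklore algebra on the operation of the cited (1.75), whose locator is the tag.)
[cite: Balaban1989LargeFieldII, (1.75) p.380] -/
theorem integral_tiltWeight_smul_eq (hρ : Integrable ρ₀ μ) (hρ0 : 0 ≤ᵐ[μ] ρ₀) (hP : 0 < ∫ z, ρ₀ z ∂μ)
    (hσm : AEStronglyMeasurable σ μ) (hWm : AEStronglyMeasurable W μ) (hσ : ∀ᵐ z ∂μ, ‖σ z‖ ≤ s)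
    (hW : ∀ᵐ z ∂μ, ‖W z‖ ≤ B) (h : Z → F) {t : ℂ} (ht : s + ‖t‖ * B ≤ 1) :
    ∫ z, tiltWeight ρ₀ σ W t z • h z ∂μ =
      (Complex.exp (dressLog μ ρ₀ σ W t) * tiltNorm μ ρ₀ σ W 0) • tiltedMean μ ρ₀ σ W h t := by
  rw [exp_dressLog_mul hρ hρ0 hP hσm hWm hσ hW ht, tiltedMean, smul_smul, ← tiltNorm_def,
    mul_inv_cancel₀ (tiltNorm_ne_zero hρ hρ0 hP hσm hWm hσ hW ht), one_smul]

/-! ## §2 Holomorphy in the source: the logarithmic derivative is the tilted mean of the observable -/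

/-- The normalisation is differentiable in the source at every `t`, with derivative `∫ρ₀e^{σ+tW}·W` (the sibling's
`hasDerivAt_integral_tiltWeight`, renamed to the carrier). (NOT PRINTED as a display: folklore calculus about the integrand of the
cited (1.73), whose locator is the tag.) [cite: Balaban1989LargeFieldII, (1.73) p.380] -/
theorem hasDerivAt_tiltNorm (hρ : Integrable ρ₀ μ) (hσm : AEStronglyMeasurable σ μ) (hWm : AEStronglyMeasurable W μ)
    (hσ : ∀ᵐ z ∂μ, ‖σ z‖ ≤ s) (hW : ∀ᵐ z ∂μ, ‖W z‖ ≤ B) (hB : 0 ≤ B) (t : ℂ) :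
    HasDerivAt (fun τ : ℂ => tiltNorm μ ρ₀ σ W τ) (∫ z, tiltWeight ρ₀ σ W t z * W z ∂μ) t :=
  hasDerivAt_integral_tiltWeight hρ hσm hWm hσ hW hB t

/-- The scalar tilted mean of the observable IS the logarithmic derivative quotient `(∫ρ₀e^{σ+tW}W) ∕ (∫ρ₀e^{σ+tW})`.
[cite: Balaban1989LargeFieldII, (1.75) p.380] -/
theorem tiltedMean_self_eq_div (μ : Measure Z) (ρ₀ : Z → ℝ) (σ W : Z → ℂ) (t : ℂ) :
    tiltedMean μ ρ₀ σ W W t = (∫ z, tiltWeight ρ₀ σ W t z * W z ∂μ) / tiltNorm μ ρ₀ σ W t := by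
  rw [tiltedMean, smul_eq_mul, div_eq_inv_mul, tiltNorm_def]
  rfl

/-- **THE LOGARITHMIC DERIVATIVE**: on the closed tilt disc `s + |t|B ≤ 1` the born term is differentiable in the source with
derivative THE TILTED MEAN OF THE OBSERVABLE, `d∕dt D_t = E_t W` (chain rule through the principal logarithm on the slit plane,
Mathlib `HasDerivAt.clog`). (NOT PRINTED as a display: folklore calculus on the normalisations of the cited (1.74)∕(1.75), whose
locator is the tag.) [cite: Balaban1989LargeFieldII, (1.75) p.380] -/
theorem hasDerivAt_dressLog (hρ : Integrable ρ₀ μ) (hρ0 : 0 ≤ᵐ[μ] ρ₀) (hP : 0 < ∫ z, ρ₀ z ∂μ)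
    (hσm : AEStronglyMeasurable σ μ) (hWm : AEStronglyMeasurable W μ) (hσ : ∀ᵐ z ∂μ, ‖σ z‖ ≤ s)
    (hW : ∀ᵐ z ∂μ, ‖W z‖ ≤ B) {t : ℂ} (ht : s + ‖t‖ * B ≤ 1) :
    HasDerivAt (fun τ : ℂ => dressLog μ ρ₀ σ W τ) (tiltedMean μ ρ₀ σ W W t) t := by
  have hB : 0 ≤ B := nonneg_of_ae_norm_le' hP hW
  have hd := (hasDerivAt_tiltNorm hρ hσm hWm hσ hW hB t).clog (tiltNorm_mem_slitPlane hρ hρ0 hP hσm hWm hσ hW ht)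
  rw [tiltedMean_self_eq_div]
  exact hd.sub_const _

/-- Holomorphy in the source: `t ↦ D_t` is `DifferentiableOn ℂ` the open tilt disc `{t | s + |t|B < 1}`. (NOT PRINTED as a display:
folklore calculus on the normalisations of the cited (1.74)∕(1.75), whose locator is the tag.) [cite: Balaban1989LargeFieldII, (1.75) p.380] -/
theorem differentiableOn_dressLog (hρ : Integrable ρ₀ μ) (hρ0 : 0 ≤ᵐ[μ] ρ₀) (hP : 0 < ∫ z, ρ₀ z ∂μ)
    (hσm : AEStronglyMeasurable σ μ) (hWm : AEStronglyMeasurable W μ) (hσ : ∀ᵐ z ∂μ, ‖σ z‖ ≤ s)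
    (hW : ∀ᵐ z ∂μ, ‖W z‖ ≤ B) :
    DifferentiableOn ℂ (fun τ : ℂ => dressLog μ ρ₀ σ W τ) {t : ℂ | s + ‖t‖ * B < 1} :=
  fun _t ht => (hasDerivAt_dressLog hρ hρ0 hP hσm hWm hσ hW (le_of_lt ht)).differentiableAt.differentiableWithinAt

/-- Analyticity in the source on the open tilt disc (holomorphy on an open set). (NOT PRINTED as a display: folklore calculus on
the normalisations of the cited (1.74)∕(1.75), whose locator is the tag.) [cite: Balaban1989LargeFieldII, (1.75) p.380] -/
theorem analyticOnNhd_dressLog (hρ : Integrable ρ₀ μ) (hρ0 : 0 ≤ᵐ[μ] ρ₀) (hP : 0 < ∫ z, ρ₀ z ∂μ)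
    (hσm : AEStronglyMeasurable σ μ) (hWm : AEStronglyMeasurable W μ) (hσ : ∀ᵐ z ∂μ, ‖σ z‖ ≤ s)
    (hW : ∀ᵐ z ∂μ, ‖W z‖ ≤ B) :
    AnalyticOnNhd ℂ (fun τ : ℂ => dressLog μ ρ₀ σ W τ) {t : ℂ | s + ‖t‖ * B < 1} :=
  (differentiableOn_dressLog hρ hρ0 hP hσm hWm hσ hW).analyticOnNhd
    (isOpen_lt (continuous_const.add (continuous_norm.mul continuous_const)) continuous_const)

/-! ## §3 Sizes: the birth bound (first order in the source) and the (1.73)∕(1.74) real-part sandwich -/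

/-- Points of the closed ball of radius `|t|` about `0` lie in the tilt disc of `t`. [folklore] -/
private theorem disc_of_mem_closedBall {t τ : ℂ} {s B : ℝ} (hB : 0 ≤ B) (hτ : τ ∈ closedBall (0 : ℂ) ‖t‖) :
    s + ‖τ‖ * B ≤ s + ‖t‖ * B := by
  have hτ' : ‖τ‖ ≤ ‖t‖ := by simpa using hτ
  have := mul_le_mul_of_nonneg_right hτ' hB
  linarith

/-- **THE BIRTH SIZE — FIRST ORDER IN THE SOURCE**: on the tilt disc `‖D_t‖ ≤ B·e^{3(s+|t|B)}·|t|` — the mean value inequality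
along the closed ball of radius `|t|` (convex), on which `D` has derivative the tilted mean `E_τ W`, bounded by (1.75)ₜ applied to
the observable itself (`‖E_τ W‖ ≤ e^{3(s+|τ|B)}·B`).  The born dressed term is proportional to the source radius times the
observable's bound: the amplitude a booking of observable-attached terms starts from. (NOT PRINTED as a display: folklore calculus
on the normalisations of the cited (1.74)∕(1.75), whose locator is the tag.) [cite: Balaban1989LargeFieldII, (1.75) p.380] -/
theorem norm_dressLog_le (hρ : Integrable ρ₀ μ) (hρ0 : 0 ≤ᵐ[μ] ρ₀) (hP : 0 < ∫ z, ρ₀ z ∂μ)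
    (hσm : AEStronglyMeasurable σ μ) (hWm : AEStronglyMeasurable W μ) (hσ : ∀ᵐ z ∂μ, ‖σ z‖ ≤ s)
    (hW : ∀ᵐ z ∂μ, ‖W z‖ ≤ B) {t : ℂ} (ht : s + ‖t‖ * B ≤ 1) :
    ‖dressLog μ ρ₀ σ W t‖ ≤ B * Real.exp (3 * (s + ‖t‖ * B)) * ‖t‖ := by
  have hB : 0 ≤ B := nonneg_of_ae_norm_le' hP hW
  have hderiv : ∀ τ ∈ closedBall (0 : ℂ) ‖t‖,
      HasDerivWithinAt (fun τ : ℂ => dressLog μ ρ₀ σ W τ) (tiltedMean μ ρ₀ σ W W τ) (closedBall (0 : ℂ) ‖t‖) τ :=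
    fun τ hτ => (hasDerivAt_dressLog hρ hρ0 hP hσm hWm hσ hW ((disc_of_mem_closedBall hB hτ).trans ht)).hasDerivWithinAt
  have hbound : ∀ τ ∈ closedBall (0 : ℂ) ‖t‖, ‖tiltedMean μ ρ₀ σ W W τ‖ ≤ B * Real.exp (3 * (s + ‖t‖ * B)) := by
    intro τ hτ
    have hτ1 := disc_of_mem_closedBall (s := s) hB hτ
    refine (norm_tiltedMean_le (F := ℂ) hρ hρ0 hP hσm hWm hσ hW hW hB (hτ1.trans ht)).trans ?_
    rw [mul_comm]
    exact mul_le_mul_of_nonneg_left (Real.exp_le_exp.mpr (by linarith)) hB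
  have key := (convex_closedBall (0 : ℂ) ‖t‖).norm_image_sub_le_of_norm_hasDerivWithin_le hderiv hbound
    (mem_closedBall_self (norm_nonneg t)) (by simp : t ∈ closedBall (0 : ℂ) ‖t‖)
  simpa [dressLog_zero] using key

/-- The real part of the born term is the log-ratio of the moduli of the normalisations (`Complex.log_re`).
[cite: Balaban1989LargeFieldII, (1.74) p.380] -/
theorem re_dressLog (μ : Measure Z) (ρ₀ : Z → ℝ) (σ W : Z → ℂ) (t : ℂ) :
    (dressLog μ ρ₀ σ W t).re = Real.log ‖tiltNorm μ ρ₀ σ W t‖ - Real.log ‖tiltNorm μ ρ₀ σ W 0‖ := by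
  rw [dressLog, Complex.sub_re, Complex.log_re, Complex.log_re]

/-- **(1.73)ₜ∕(1.74)ₜ READ ON THE BORN TERM, UPPER HALF**: `Re D_t ≤ 3s + |t|B` — from `‖𝐓′ₜ1‖ ≤ (∫ρ₀)e^{s+|t|B}` and
`‖𝐓′₀1‖ ≥ (∫ρ₀)e^{−2s}` (derivative-free; it carries the action margin `3s` and is therefore NOT first order in the source — the
first-order statement is `norm_dressLog_le`). [cite: Balaban1989LargeFieldII, (1.73) p.380] -/
theorem re_dressLog_le (hρ : Integrable ρ₀ μ) (hρ0 : 0 ≤ᵐ[μ] ρ₀) (hP : 0 < ∫ z, ρ₀ z ∂μ)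
    (hσm : AEStronglyMeasurable σ μ) (hWm : AEStronglyMeasurable W μ) (hσ : ∀ᵐ z ∂μ, ‖σ z‖ ≤ s)
    (hW : ∀ᵐ z ∂μ, ‖W z‖ ≤ B) {t : ℂ} (ht : s + ‖t‖ * B ≤ 1) :
    (dressLog μ ρ₀ σ W t).re ≤ 3 * s + ‖t‖ * B := by
  have hB : 0 ≤ B := nonneg_of_ae_norm_le' hP hW
  have h0 : s + ‖(0 : ℂ)‖ * B ≤ 1 := by
    rw [norm_zero, zero_mul, add_zero]; nlinarith [norm_nonneg t]
  have hlo0 := mul_exp_le_norm_tiltNorm hρ hρ0 hσm hWm hσ hW h0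
  rw [norm_zero, zero_mul, add_zero] at hlo0
  have hhit := norm_tiltNorm_le hρ hρ0 hσ hW t
  have hpos0 : 0 < (∫ z, ρ₀ z ∂μ) * Real.exp (-(2 * s)) := mul_pos hP (Real.exp_pos _)
  have hpost : 0 < ‖tiltNorm μ ρ₀ σ W t‖ :=
    norm_pos_iff.mpr (tiltNorm_ne_zero hρ hρ0 hP hσm hWm hσ hW ht)
  rw [re_dressLog]
  have h1 : Real.log ‖tiltNorm μ ρ₀ σ W t‖ ≤ Real.log (∫ z, ρ₀ z ∂μ) + (s + ‖t‖ * B) := by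
    rw [← Real.log_exp (s + ‖t‖ * B), ← Real.log_mul hP.ne' (Real.exp_pos _).ne']
    exact Real.log_le_log hpost hhit
  have h2 : Real.log (∫ z, ρ₀ z ∂μ) + -(2 * s) ≤ Real.log ‖tiltNorm μ ρ₀ σ W 0‖ := by
    rw [← Real.log_exp (-(2 * s)), ← Real.log_mul hP.ne' (Real.exp_pos _).ne']
    exact Real.log_le_log hpos0 hlo0
  linarith

/-- **(1.73)ₜ∕(1.74)ₜ READ ON THE BORN TERM, LOWER HALF**: `−(3s + 2|t|B) ≤ Re D_t` — from `‖𝐓′ₜ1‖ ≥ (∫ρ₀)e^{−2(s+|t|B)}` and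
`‖𝐓′₀1‖ ≤ (∫ρ₀)e^{s}`. [cite: Balaban1989LargeFieldII, (1.74) p.380] -/
theorem neg_le_re_dressLog (hρ : Integrable ρ₀ μ) (hρ0 : 0 ≤ᵐ[μ] ρ₀) (hP : 0 < ∫ z, ρ₀ z ∂μ)
    (hσm : AEStronglyMeasurable σ μ) (hWm : AEStronglyMeasurable W μ) (hσ : ∀ᵐ z ∂μ, ‖σ z‖ ≤ s)
    (hW : ∀ᵐ z ∂μ, ‖W z‖ ≤ B) {t : ℂ} (ht : s + ‖t‖ * B ≤ 1) :
    -(3 * s + 2 * (‖t‖ * B)) ≤ (dressLog μ ρ₀ σ W t).re := by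
  have hB : 0 ≤ B := nonneg_of_ae_norm_le' hP hW
  have h0 : s + ‖(0 : ℂ)‖ * B ≤ 1 := by
    rw [norm_zero, zero_mul, add_zero]; nlinarith [norm_nonneg t]
  have hhi0 := norm_tiltNorm_le hρ hρ0 hσ hW (0 : ℂ)
  rw [norm_zero, zero_mul, add_zero] at hhi0
  have hlot := mul_exp_le_norm_tiltNorm hρ hρ0 hσm hWm hσ hW ht
  have hpost : 0 < (∫ z, ρ₀ z ∂μ) * Real.exp (-(2 * (s + ‖t‖ * B))) := mul_pos hP (Real.exp_pos _)
  have hpos0 : 0 < ‖tiltNorm μ ρ₀ σ W 0‖ :=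
    norm_pos_iff.mpr (tiltNorm_ne_zero hρ hρ0 hP hσm hWm hσ hW h0)
  rw [re_dressLog]
  have h1 : Real.log (∫ z, ρ₀ z ∂μ) + -(2 * (s + ‖t‖ * B)) ≤ Real.log ‖tiltNorm μ ρ₀ σ W t‖ := by
    rw [← Real.log_exp (-(2 * (s + ‖t‖ * B))), ← Real.log_mul hP.ne' (Real.exp_pos _).ne']
    exact Real.log_le_log hpost hlot
  have h2 : Real.log ‖tiltNorm μ ρ₀ σ W 0‖ ≤ Real.log (∫ z, ρ₀ z ∂μ) + s := by
    rw [← Real.log_exp s, ← Real.log_mul hP.ne' (Real.exp_pos _).ne']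
    exact Real.log_le_log hpos0 hhi0
  linarith

/-! ## §4 The oscillation form (only the fibre-oscillation of the observable is born) and the second-order remainder -/

omit [MeasurableSpace Z] in
/-- A constant shift of the observable multiplies the tilted weight by the nonzero scalar `e^{tc}`. (NOT PRINTED as a display:
folklore algebra on the weight of the cited (1.73), whose locator is the tag.) [cite: Balaban1989LargeFieldII, (1.73) p.380] -/
theorem tiltWeight_add_const (ρ₀ : Z → ℝ) (σ W : Z → ℂ) (c t : ℂ) (z : Z) :
    tiltWeight ρ₀ σ (fun z => W z + c) t z = Complex.exp (t * c) * tiltWeight ρ₀ σ W t z := by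
  rw [tiltWeight_apply, tiltWeight_apply, mul_add, ← add_assoc, Complex.exp_add]
  ring

/-- **THE NORMALISED EXPECTATION IS BLIND TO A CONSTANT SHIFT OF THE OBSERVABLE**: `E_t^{W+c} h = E_t^{W} h` for every
constant `c` — the factor `e^{tc}` leaves both integrals and cancels in the ratio (no hypothesis: in the degenerate case both
sides are the junk value).  This is why only the OSCILLATION of the observable over the integrated fibre enters the dressed
expectation. (NOT PRINTED as a display: folklore algebra on the operation of the cited (1.75), whose locator is the tag.)
[cite: Balaban1989LargeFieldII, (1.75) p.380] -/
theorem tiltedMean_add_const (μ : Measure Z) (ρ₀ : Z → ℝ) (σ W : Z → ℂ) (c : ℂ) (h : Z → F) (t : ℂ) :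
    tiltedMean μ ρ₀ σ (fun z => W z + c) h t = tiltedMean μ ρ₀ σ W h t := by
  have hne : Complex.exp (t * c) ≠ 0 := Complex.exp_ne_zero _
  simp only [tiltedMean, tiltWeight_add_const]
  rw [integral_const_mul]
  have hsm : (fun z => (Complex.exp (t * c) * tiltWeight ρ₀ σ W t z) • h z)
      = fun z => Complex.exp (t * c) • (tiltWeight ρ₀ σ W t z • h z) := by
    funext z; rw [smul_smul]
  rw [hsm, integral_smul, smul_smul, mul_inv_rev, mul_assoc, inv_mul_cancel₀ hne, mul_one]

/-- Linearity of the normalised expectation in the integrand against a constant: `E_t(h − c) = E_t h − c` on the tilt disc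
(where the normalisation does not vanish). (NOT PRINTED as a display: folklore algebra on the operation of the cited (1.75),
whose locator is the tag.) [cite: Balaban1989LargeFieldII, (1.75) p.380] -/
theorem tiltedMean_sub_const [CompleteSpace F] (hρ : Integrable ρ₀ μ) (hρ0 : 0 ≤ᵐ[μ] ρ₀) (hP : 0 < ∫ z, ρ₀ z ∂μ)
    (hσm : AEStronglyMeasurable σ μ) (hWm : AEStronglyMeasurable W μ) (hσ : ∀ᵐ z ∂μ, ‖σ z‖ ≤ s)
    (hW : ∀ᵐ z ∂μ, ‖W z‖ ≤ B) (hhm : AEStronglyMeasurable h μ) (hh : ∀ᵐ z ∂μ, ‖h z‖ ≤ m) (c : F)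
    {t : ℂ} (ht : s + ‖t‖ * B ≤ 1) :
    tiltedMean μ ρ₀ σ W (fun z => h z - c) t = tiltedMean μ ρ₀ σ W h t - c := by
  have hne := tiltNorm_ne_zero hρ hρ0 hP hσm hWm hσ hW ht
  have hi1 : Integrable (fun z => tiltWeight ρ₀ σ W t z • h z) μ :=
    integrable_tiltWeight_smul hρ hσm hWm hσ hW hhm hh t
  have hi2 : Integrable (fun z => tiltWeight ρ₀ σ W t z • c) μ :=
    (integrable_tiltWeight hρ hσm hWm hσ hW t).smul_const c
  simp only [tiltedMean, smul_sub]
  rw [integral_sub hi1 hi2, integral_smul_const, smul_sub, smul_smul, ← tiltNorm_def, inv_mul_cancel₀ hne, one_smul]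

/-- **THE OSCILLATION FORM OF THE BIRTH SIZE**: if the observable stays within `B₀` of a constant `c` on the fibre
(`‖W − c‖ ≤ B₀` a.e.), then on the common tilt disc `‖D_t − t·c‖ ≤ B₀·e^{3(s+|t|B₀)}·|t|` — beyond the field-independent constant
`t·c` (which the NEXT step's normalised expectation does not see, `tiltedMean_add_const`) only the OSCILLATION `B₀` of the
observable is born.  Proof: `τ ↦ D_τ − τ·c` has derivative `E_τ^{W}(W − c) = E_τ^{W−c}(W − c)`, bounded by (1.75)ₜ for the
shifted observable.  In the cell's bookkeeping `B₀ = C_W·|Λ|·θ^{K−k}` is the oscillation of a unit-scale loop pulled back through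
`K − k` averagings over a scale-`k` fibre (`T4AvgSensitivity.LoopOscBound`, hypothesis shape) — the geometric decay of the booked
amplitudes in the age of the birth. (NOT PRINTED as a display: folklore calculus on the normalisations of the cited (1.74)∕(1.75),
whose locator is the tag.) [cite: Balaban1989LargeFieldII, (1.75) p.380] -/
theorem norm_dressLog_sub_mul_le (hρ : Integrable ρ₀ μ) (hρ0 : 0 ≤ᵐ[μ] ρ₀) (hP : 0 < ∫ z, ρ₀ z ∂μ)
    (hσm : AEStronglyMeasurable σ μ) (hWm : AEStronglyMeasurable W μ) (hσ : ∀ᵐ z ∂μ, ‖σ z‖ ≤ s)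
    (hW : ∀ᵐ z ∂μ, ‖W z‖ ≤ B) {c : ℂ} {B₀ : ℝ} (hW₀ : ∀ᵐ z ∂μ, ‖W z - c‖ ≤ B₀) {t : ℂ}
    (ht : s + ‖t‖ * B ≤ 1) (ht₀ : s + ‖t‖ * B₀ ≤ 1) :
    ‖dressLog μ ρ₀ σ W t - t * c‖ ≤ B₀ * Real.exp (3 * (s + ‖t‖ * B₀)) * ‖t‖ := by
  have hB : 0 ≤ B := nonneg_of_ae_norm_le' hP hW
  have hB₀ : 0 ≤ B₀ := nonneg_of_ae_norm_le' hP hW₀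
  have hWm₀ : AEStronglyMeasurable (fun z => W z - c) μ := hWm.sub aestronglyMeasurable_const
  -- the observable W is (W − c) + c: its normalised expectations are those of the shifted observable
  have hshift : ∀ τ : ℂ, tiltedMean μ ρ₀ σ W (fun z => W z - c) τ = tiltedMean μ ρ₀ σ (fun z => W z - c) (fun z => W z - c) τ := by
    intro τ
    have e := tiltedMean_add_const (F := ℂ) μ ρ₀ σ (fun z => W z - c) c (fun z => W z - c) τ
    simp only [sub_add_cancel] at e
    exact e
  have hderiv : ∀ τ ∈ closedBall (0 : ℂ) ‖t‖,
      HasDerivWithinAt (fun τ : ℂ => dressLog μ ρ₀ σ W τ - τ * c)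
        (tiltedMean μ ρ₀ σ (fun z => W z - c) (fun z => W z - c) τ) (closedBall (0 : ℂ) ‖t‖) τ := by
    intro τ hτ
    have hτ1 : s + ‖τ‖ * B ≤ 1 := (disc_of_mem_closedBall hB hτ).trans ht
    have hD := hasDerivAt_dressLog hρ hρ0 hP hσm hWm hσ hW hτ1
    have hL : HasDerivAt (fun τ : ℂ => τ * c) (1 * c) τ := (hasDerivAt_id τ).mul_const c
    have hsub := hD.sub hL
    rw [one_mul, ← tiltedMean_sub_const (F := ℂ) hρ hρ0 hP hσm hWm hσ hW hWm hW c hτ1, hshift τ] at hsub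
    exact hsub.hasDerivWithinAt
  have hbound : ∀ τ ∈ closedBall (0 : ℂ) ‖t‖,
      ‖tiltedMean μ ρ₀ σ (fun z => W z - c) (fun z => W z - c) τ‖ ≤ B₀ * Real.exp (3 * (s + ‖t‖ * B₀)) := by
    intro τ hτ
    have hτ1 := disc_of_mem_closedBall (s := s) hB₀ hτ
    refine (norm_tiltedMean_le (F := ℂ) hρ hρ0 hP hσm hWm₀ hσ hW₀ hW₀ hB₀ (hτ1.trans ht₀)).trans ?_
    rw [mul_comm]
    exact mul_le_mul_of_nonneg_left (Real.exp_le_exp.mpr (by linarith)) hB₀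
  have key := (convex_closedBall (0 : ℂ) ‖t‖).norm_image_sub_le_of_norm_hasDerivWithin_le hderiv hbound
    (mem_closedBall_self (norm_nonneg t)) (by simp : t ∈ closedBall (0 : ℂ) ‖t‖)
  simpa [dressLog_zero] using key

/-- **THE SECOND-ORDER REMAINDER PAST THE LINEAR PART**: on the tilt disc `‖D_t − t·E₀W‖ ≤ 2B²·e^{6(s+|t|B)}·|t|²` — the born term is
its linear part `t·⟨W⟩₀` (the undressed normalised mean of the observable, the part the cell's `T4FirstOrderSize` charges to the
quadratic currency) plus a remainder of SECOND order in the amplitude `B` (mean value inequality on `τ ↦ D_τ − τ·E₀W`, whose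
derivative `E_τW − E₀W` is bounded by the sibling's first-order dressing size `2B·e^{6(s+|τ|B)}·B·|τ|`). (NOT PRINTED as a display:
folklore calculus on the normalisations of the cited (1.74)∕(1.75), whose locator is the tag.) [cite: Balaban1989LargeFieldII, (1.75) p.380] -/
theorem norm_dressLog_sub_linear_le (hρ : Integrable ρ₀ μ) (hρ0 : 0 ≤ᵐ[μ] ρ₀) (hP : 0 < ∫ z, ρ₀ z ∂μ)
    (hσm : AEStronglyMeasurable σ μ) (hWm : AEStronglyMeasurable W μ) (hσ : ∀ᵐ z ∂μ, ‖σ z‖ ≤ s)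
    (hW : ∀ᵐ z ∂μ, ‖W z‖ ≤ B) {t : ℂ} (ht : s + ‖t‖ * B ≤ 1) :
    ‖dressLog μ ρ₀ σ W t - t * tiltedMean μ ρ₀ σ W W 0‖ ≤ 2 * B ^ 2 * Real.exp (6 * (s + ‖t‖ * B)) * ‖t‖ ^ 2 := by
  have hB : 0 ≤ B := nonneg_of_ae_norm_le' hP hW
  set E0 : ℂ := tiltedMean μ ρ₀ σ W W 0 with hE0
  have hderiv : ∀ τ ∈ closedBall (0 : ℂ) ‖t‖,
      HasDerivWithinAt (fun τ : ℂ => dressLog μ ρ₀ σ W τ - τ * E0)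
        (tiltedMean μ ρ₀ σ W W τ - E0) (closedBall (0 : ℂ) ‖t‖) τ := by
    intro τ hτ
    have hτ1 : s + ‖τ‖ * B ≤ 1 := (disc_of_mem_closedBall hB hτ).trans ht
    have hD := hasDerivAt_dressLog hρ hρ0 hP hσm hWm hσ hW hτ1
    have hL : HasDerivAt (fun τ : ℂ => τ * E0) (1 * E0) τ := (hasDerivAt_id τ).mul_const E0
    have hsub := hD.sub hL
    rw [one_mul] at hsub
    exact hsub.hasDerivWithinAt
  have hbound : ∀ τ ∈ closedBall (0 : ℂ) ‖t‖,
      ‖tiltedMean μ ρ₀ σ W W τ - E0‖ ≤ 2 * B ^ 2 * Real.exp (6 * (s + ‖t‖ * B)) * ‖t‖ := by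
    intro τ hτ
    have hτ' : ‖τ‖ ≤ ‖t‖ := by simpa using hτ
    have hτ1 := disc_of_mem_closedBall (s := s) hB hτ
    refine (norm_tiltedMean_sub_tiltedMean_zero_le (F := ℂ) hρ hρ0 hP hσm hWm hσ hW hWm hW hB (hτ1.trans ht)).trans ?_
    have hexp : Real.exp (6 * (s + ‖τ‖ * B)) ≤ Real.exp (6 * (s + ‖t‖ * B)) := Real.exp_le_exp.mpr (by linarith)
    calc 2 * B * Real.exp (6 * (s + ‖τ‖ * B)) * B * ‖τ‖
        = 2 * B ^ 2 * (Real.exp (6 * (s + ‖τ‖ * B)) * ‖τ‖) := by ring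
      _ ≤ 2 * B ^ 2 * (Real.exp (6 * (s + ‖t‖ * B)) * ‖t‖) :=
          mul_le_mul_of_nonneg_left (mul_le_mul hexp hτ' (norm_nonneg _) (Real.exp_pos _).le) (by positivity)
      _ = 2 * B ^ 2 * Real.exp (6 * (s + ‖t‖ * B)) * ‖t‖ := by ring
  have key := (convex_closedBall (0 : ℂ) ‖t‖).norm_image_sub_le_of_norm_hasDerivWithin_le hderiv hbound
    (mem_closedBall_self (norm_nonneg t)) (by simp : t ∈ closedBall (0 : ℂ) ‖t‖)
  have e : 2 * B ^ 2 * Real.exp (6 * (s + ‖t‖ * B)) * ‖t‖ * ‖t‖ = 2 * B ^ 2 * Real.exp (6 * (s + ‖t‖ * B)) * ‖t‖ ^ 2 := by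
    ring
  simpa [dressLog_zero, e] using key

/-! ## §5 Cauchy bounds on the higher source derivatives of the born term -/

/-- **CAUCHY BOUNDS ON THE HIGHER SOURCE DERIVATIVES OF THE BORN TERM**: for `0 < R` with `s + (|t₀| + R)·B ≤ 1`,
`‖∂ⁿ⁺¹_t D_t |_{t₀}‖ ≤ n! · e^{3(s+(|t₀|+R)B)} · B ∕ Rⁿ` — the `(n+1)`-st derivative of `D` is the `n`-th derivative of its
logarithmic derivative `E_t W` near `t₀` (the open ball of radius `R` lies in the closed tilt disc), to which the sibling's Cauchy
bound `norm_iteratedDeriv_tiltedMean_le` applies. (NOT PRINTED as a display: folklore calculus on the normalisations of the cited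
(1.74)∕(1.75), whose locator is the tag.) [cite: Balaban1989LargeFieldII, (1.75) p.380] -/
theorem norm_iteratedDeriv_dressLog_succ_le (hρ : Integrable ρ₀ μ) (hρ0 : 0 ≤ᵐ[μ] ρ₀) (hP : 0 < ∫ z, ρ₀ z ∂μ)
    (hσm : AEStronglyMeasurable σ μ) (hWm : AEStronglyMeasurable W μ) (hσ : ∀ᵐ z ∂μ, ‖σ z‖ ≤ s)
    (hW : ∀ᵐ z ∂μ, ‖W z‖ ≤ B) {t₀ : ℂ} {R : ℝ} (hR0 : 0 < R) (hR : s + (‖t₀‖ + R) * B ≤ 1) (n : ℕ) :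
    ‖iteratedDeriv (n + 1) (fun τ : ℂ => dressLog μ ρ₀ σ W τ) t₀‖
      ≤ n.factorial * (Real.exp (3 * (s + (‖t₀‖ + R) * B)) * B) / R ^ n := by
  have hB : 0 ≤ B := nonneg_of_ae_norm_le' hP hW
  -- near t₀ the derivative of D is the tilted mean of W
  have hev : deriv (fun τ : ℂ => dressLog μ ρ₀ σ W τ) =ᶠ[𝓝 t₀] fun τ => tiltedMean μ ρ₀ σ W W τ := by
    filter_upwards [ball_mem_nhds t₀ hR0] with τ hτ
    have hτ' : ‖τ‖ ≤ ‖t₀‖ + R := by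
      have hd : ‖τ - t₀‖ < R := mem_ball_iff_norm.mp hτ
      calc ‖τ‖ = ‖t₀ + (τ - t₀)‖ := by rw [add_sub_cancel]
        _ ≤ ‖t₀‖ + ‖τ - t₀‖ := norm_add_le _ _
        _ ≤ ‖t₀‖ + R := by linarith
    have hτ1 : s + ‖τ‖ * B ≤ 1 := by
      have hmono := mul_le_mul_of_nonneg_right hτ' hB
      linarith
    exact (hasDerivAt_dressLog hρ hρ0 hP hσm hWm hσ hW hτ1).deriv
  rw [iteratedDeriv_succ', Filter.EventuallyEq.iteratedDeriv_eq n hev]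
  exact norm_iteratedDeriv_tiltedMean_le (F := ℂ) hρ hρ0 hP hσm hWm hσ hW hWm hW hB hR0 hR n

end Literature.MathematicalPhysics.QuantumFieldTheory.Balaban1983to89.B16DressedActionTerm

end
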